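import Summits.Parity.GeneralizedHardyLittlewood.Theorems.Dhl42DefsRegions

/-!
# DHL[42,2] certificate — the 126 F-side cover members, their bins, and the cross term (Section 7.3, eqs. (15)/(17)/(19)/(23))

The cover members `Member` of Section 7.3 (two-level sets at the 36 union levels `u_l ≥ 1/10` on
each of the three depth bands, one-level whole-layer sets at the 18 levels `u_l < 1/10`), their sets
`Esets`, bin bases `memberTau0`, bin families `MemberBins`/`binSet`/`Nbin`, the fibre quantities
`Aval`, `lenJI`, `Bval`, the per-member cross term `crossOf` and the total `totalCross` of eq. (15);
plus `memberTau0_pos`, `lenJI_nonneg`, `totalCross_nonneg`. NOT here: that the members cover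
`S·R_42 ∖ Ω` (→ `Dhl42Cover`); the smoke bin family `binsSmoke` of the package is not migrated.

Origin: the verbatim leg `Dhl42/TpY4Dhl42.lean` of the DHL[42,2] certificate package (pub-dhl42
bundle, archive blob `18cce9e3`; paper snapshot = `paper/main.tex` v1), lines :948–:1036 and
:2460–:2475, :2494–:2501; statements and proofs unchanged except: namespace `TpY4Dhl42` →
`Summit.Parity.GeneralizedHardyLittlewood.Theorems.Dhl42`, the package's `simplexSet n B` replaced
by the tree's definitionally equal `Literature.NumberTheory.Sieve.scaledSimplex n B`
(`PolymathBoundedGaps.lean`), docstrings added where missing.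

Declarations (17): `toU`, `bandLo`, `inBand`, `Member`, `Esets`, `memberTau0`, `MemberBins`,
`binSet`, `Nbin`, `Aval`, `lenJI`, `Bval`, `crossOf`, `totalCross`, `memberTau0_pos`,
`lenJI_nonneg`, `totalCross_nonneg`.
-/

open MeasureTheory
open Literature.NumberTheory.Sieve (scaledSimplex)

namespace Summit.Parity.GeneralizedHardyLittlewood.Theorems.Dhl42

noncomputable section

/-! ### The F-side cover members (Section 7.3)

"On each of the three depth bands, two-level sets (eq. (19)) at the 36
levels `u_l ≥ 1/10`, and one-level sets at the 18 levels `u_l < 1/10`, the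
latter taken over the whole layer `[0, ε_{2,1})` (their thresholds do not
depend on the band)": `3·36 + 18 = 126` members.  The two-level condition at
the top level `l = 53` uses the sentinel (`u_54 := S + ρ₀` with threshold
`0`), which holds vacuously on `S·R_42` (`bigU_sentinel`), i.e. that member
is one-level, as in eq. (23) with `u_Λ := ∞`. -/

/-- Union-grid index of the `l`-th two-level level (`u_{l+18} ≥ 1/10`). -/
def toU (l : Fin 36) : Fin 54 := ⟨l.1 + 18, by omega⟩

/-- Lower depth edge of band `g`: `ε_{2,2}, ε_{2,3}, 0`. -/
def bandLo : Fin 3 → ℝ := ![eps2 1, eps2 2, 0]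

/-- Depth band `g` (paper: `b_g = [ε_{2,g+1}, ε_{2,g})`, `ε_{2,4} := 0`),
as a condition on `s = Σt`. -/
def inBand (g : Fin 3) (s : ℝ) : Prop := bandLo g ≤ Sc - s ∧ Sc - s < eps2 g

/-- Index type of the 126 F-side cover members: `inl (g, l)` = the two-level
member of band `g` at union level `18 + l`; `inr l` = the one-level member at
union level `l < 18` over the whole layer. -/
abbrev Member : Type := (Fin 3 × Fin 36) ⊕ Fin 18

/-- The F-side cover members (eq. (23) and the reductions described above). -/
def Esets : Member → Set (Fin 42 → ℝ)
  | .inl (g, l) =>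
      {t ∈ scaledSimplex 42 Sc |
        inBand g (∑ j, t j) ∧ tauFband g (toU l) < bigU t (uvec (toU l)) ∧
          bigU t (uvecE (toU l).succ) ≤ tauFbandE g (toU l).succ}
  | .inr l =>
      {t ∈ scaledSimplex 42 Sc |
        Sc - eps2 0 < ∑ j, t j ∧
          tauFband 0 (Fin.castLE (by omega) l) < bigU t (uvec (Fin.castLE (by omega) l))}

/-- `E ⊆ {Σt > S - e}` with `e = ε_{2,g}` (band members) or `ε_{2,1}`
(layer members); `τ₀ = S - e - K` is the corresponding bin base
(Lemma 6.2). -/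
def memberTau0 : Member → ℝ
  | .inl (g, _) => tau0g g
  | .inr _ => tau0g 0

/-- A bin family for one cover member with base `τ₀`: boundaries
`τ₀ = b_0 < b_1 < … < b_n` with `b_n > S`, bins `β_i = [b_i, b_{i+1})`
(Lemma 6.2). -/
structure MemberBins (t0 : ℝ) where
  /-- Number of bins. -/
  n : ℕ
  /-- The `n + 1` bin boundaries. -/
  bnd : Fin (n + 1) → ℝ
  mono : StrictMono bnd
  first : bnd 0 = t0
  last : Sc < bnd (Fin.last n)

/-- The `i`-th bin `β_i = [b_i, b_{i+1})` of a bin family. -/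
def binSet {t0 : ℝ} (mb : MemberBins t0) (i : Fin mb.n) : Set ℝ :=
  Set.Ico (mb.bnd i.castSucc) (mb.bnd i.succ)

open scoped Classical in
/-- `N_β(t) = #{m : t_m ∈ β}` (Lemma 6.2, with the allowance dropping
`Σt^{(m)} ≤ K`). -/
def Nbin (β : Set ℝ) (t : Fin 42 → ℝ) : ℕ :=
  (Finset.univ.filter fun m => t m ∈ β).card

/-- `A_{jβ} = ∫_{E_j} F_0(t)² N_β(t) dt` (eq. (16)). -/
def Aval (m : Member) (β : Set ℝ) : ℝ := ∫ t in Esets m, F0 t ^ 2 * (Nbin β t : ℝ)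

/-- `ℓ_{jβ}(t') = |{t_1 ∈ β ∩ [0, S - Σt'] : (t_1, t') ∈ E_j}|` (Lebesgue
measure; Lemma 6.2). -/
def lenJI (m : Member) (β : Set ℝ) (t' : Fin 41 → ℝ) : ℝ :=
  (volume {s : ℝ | (s ∈ β ∧ s ∈ Set.Icc (0 : ℝ) (Sc - ∑ j, t' j)) ∧
    Fin.cons s t' ∈ Esets m}).toReal

/-- `B_{jβ} = k ∫_{Ω'} (F_0)_1(t')² ℓ_{jβ}(t') dt'` (eq. (16), `k = 42`;
the computation's Ω'-restricted form). -/
def Bval (m : Member) (β : Set ℝ) : ℝ :=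
  42 * ∫ t' in OmegaG, F0marg t' ^ 2 * lenJI m β t'

/-- The binned Cauchy–Schwarz cross sum of one member,
`Σ_i √(A_{jβ_i} B_{jβ_i})` (eqs. (15)/(17)). -/
def crossOf (m : Member) (mb : MemberBins (memberTau0 m)) : ℝ :=
  ∑ i, Real.sqrt (Aval m (binSet mb i) * Bval m (binSet mb i))

/-- The total cross term `Σ_{j∈J} Σ_i √(A_{ji} B_{ji})` of eq. (15) for a
choice of bin family on each of the 126 members. -/
def totalCross (bf : ∀ m : Member, MemberBins (memberTau0 m)) : ℝ :=
  ∑ m : Member, crossOf m (bf m)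

/-- Smoke: every member's bin base `τ_{0,g} = S - K - ε_{2,g}` is positive
(the requirement `e_j < S - K` of Lemma 6.2). -/
theorem memberTau0_pos : ∀ m : Member, 0 < memberTau0 m := by
  intro m
  have h : ∀ g : Fin 3, 0 < tau0g g := by
    intro g
    match g with
    | 0 => rw [tau0A_eq]; norm_num
    | 1 => rw [tau0B_eq]; norm_num
    | 2 => rw [tau0C_eq]; norm_num
  rcases m with ⟨g, l⟩ | l
  · exact h g
  · exact h 0

/-- Smoke: the fibre lengths and the cross term are non-negative. -/
theorem lenJI_nonneg (m : Member) (β : Set ℝ) (t' : Fin 41 → ℝ) : 0 ≤ lenJI m β t' :=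
  ENNReal.toReal_nonneg

/-- The total cross term `Σ_{j∈J} Σ_i √(A_{ji} B_{ji})` (eq. (15)) is `≥ 0` for every choice of bin
families — a finite sum of square roots. -/
theorem totalCross_nonneg (bf : ∀ m : Member, MemberBins (memberTau0 m)) :
    0 ≤ totalCross bf :=
  Finset.sum_nonneg fun _ _ => Finset.sum_nonneg fun _ _ => Real.sqrt_nonneg _

end

end Summit.Parity.GeneralizedHardyLittlewood.Theorems.Dhl42
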